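import Summits.RiemannHypothesis.RiemannHypothesis.Theorems.GroundBartaEvenWinsBeyondArchDeflationWeightedGlue
import Summits.RiemannHypothesis.RiemannHypothesis.Theorems.GroundBartaEvenWinsBeyondArchDeflationCrossPanels
import HarnessLib

/-!
# RiemannHypothesis / GroundBarta — rung 4 (`EvenWinsBeyondArch`, stmt-RiemannHypothesis-18807 / 18085):
# the deflated Temple L-side — weighted residual Gram entries from the UNWEIGHTED per-panel bounds

Helper file (`--supports stmt-RiemannHypothesis-18807`), RH-free, no facts.  Prover B, speedrun unit `sr-gb-rung-b` (gen 4).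
With the breakpoint on the panel grid, `y₁ = n₁ · (c/m) = 2 n₁ h`, the weight `dt_wgt y₁ wI wE` is `wI` on the y-panels `j < n₁` and
`wE` on `j ≥ n₁`, so `∫ w‖r_i‖² ≤ 2 Σ_j w_j q_j` and `∫ w Re(r_i r̄_k) ∈ 2 Σ_j w_j [lo_j, hi_j]` follow from the per-panel bounds already
certified for the unweighted layer (`dt_whs_of_panelQL`, `dt_whcross_of_panelQL`).
-/

set_option linter.dupNamespace false

noncomputable section

open MeasureTheory Set Filter intervalIntegral
open scoped Topology BigOperators ComplexConjugate

namespace Summit.RiemannHypothesis.RiemannHypothesis.Theorems.EvenWinsBeyondArch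

open Literature.NumberTheory.LFunctions
open Literature.Analysis.ValidatedNumerics Literature.Analysis.ValidatedNumerics.PolyMP
  Literature.Analysis.ValidatedNumerics.NumericsMP Literature.Analysis.ValidatedNumerics.ExpPoly

section WPanels

variable {c : ℚ} {k : ℕ} {gp : Fin k → Poly} {v F : Fin k → ℝ → ℂ}

/-- the panel weight: `wI` for `j < n₁`, `wE` otherwise -/
def dt_wj (n₁ : ℕ) (wI wE : ℚ) (j : ℕ) : ℚ := if j < n₁ then wI else wE

/-- On panel `j` the weight `dt_wgt (n₁ c/m) wI wE` is the constant `dt_wj n₁ wI wE j`. -/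
theorem dt_wgt_on_panel (hc : 0 < c) {m : ℕ} (hm : 0 < m) (n₁ : ℕ) (wI wE : ℚ) {j : ℕ} {ρ : ℝ}
    (hρ : ρ ∈ Ioo (-((c / (2 * m) : ℚ) : ℝ)) ((c / (2 * m) : ℚ) : ℝ)) :
    dt_wgt (((n₁ : ℚ) * (c / m) : ℚ) : ℝ) (wI : ℝ) (wE : ℝ) ((((PolyMP.panelCentre (c / (2 * m)) j : ℚ) : ℝ)) + ρ) = ((dt_wj n₁ wI wE j : ℚ) : ℝ) := by
  have e1 : ((PolyMP.panelCentre (c / (2 * m)) j : ℚ) : ℝ) = (2 * (j : ℝ) + 1) * ((c : ℝ) / (2 * m)) := dt_panelCentre_castL c m j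
  have e2 : ((c / (2 * m) : ℚ) : ℝ) = (c : ℝ) / (2 * m) := dt_halfWidth_cast c m
  have e3 : ((((n₁ : ℚ) * (c / m) : ℚ)) : ℝ) = 2 * (n₁ : ℝ) * ((c : ℝ) / (2 * m)) := by push_cast; ring
  have hmr : (0 : ℝ) < m := by exact_mod_cast hm
  have hcr : (0 : ℝ) < c := by exact_mod_cast hc
  have hh : (0 : ℝ) < (c : ℝ) / (2 * m) := by positivity
  rw [e2] at hρ
  rw [e1, e3]
  unfold dt_wj
  split_ifs with hj
  · rw [dt_wgt_panel_interior hh (Nat.succ_le_of_lt hj) (wI : ℝ) (wE : ℝ) hρ]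
  · rw [dt_wgt_panel_edge hh (not_lt.1 hj) (wI : ℝ) (wE : ℝ) hρ]

/-- **Weighted residual norm** `∫ w‖F_i − Σ W v‖² ≤ 2 Σ_j w_j q_j` from the unweighted per-panel bounds (`w_j = dt_wj n₁ wI wE j ≥ 0`).
[cite: GoerischHaunhorst1985, §2] -/
theorem dt_whs_of_panelQL (hc : 0 < c) {σ : ℝ} (hσ : σ = 1 ∨ σ = -1)
    (hgp : ∀ i x, Poly.eval (gp i) (-x) = σ * Poly.eval (gp i) x)
    (hv : ∀ i x, v i x = (((Icc (-(c : ℝ)) c).indicator (fun x ↦ Poly.eval (gp i) x) x : ℝ) : ℂ))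
    (hF : ∀ i y, F i y = (Icc (-(c : ℝ)) c).indicator (fun y ↦
        2 * (∫ x, v i x * (Real.cosh (x / 2) : ℂ)) * (Real.cosh (y / 2) : ℂ) -
          2 * (∫ x, v i x * (Real.sinh (x / 2) : ℂ)) * (Real.sinh (y / 2) : ℂ) +
        (∑ n ∈ weilPrimeIndex (c : ℝ), (((ArithmeticFunction.vonMangoldt n : ℝ) / Real.sqrt n : ℝ) : ℂ) *
          (2 * v i y - v i (y - Real.log n) - v i (y + Real.log n))) +
        ∫ t in Ioi 0, (weilArchDensity t : ℂ) * (2 * v i y - v i (y - t) - v i (y + t))) y -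
      (weilMarkovConstant (c : ℝ) : ℂ) * v i y)
    {w1 L1 w2 L2 w3 L3 : ℝ} (Mt : ℚ) (Wt : Fin k → Fin k → ℚ) (i : Fin k)
    (hprimes : ∀ y : ℝ, ∑ n ∈ weilPrimeIndex (c : ℝ), ((ArithmeticFunction.vonMangoldt n : ℝ) / Real.sqrt n) *
        (2 * Poly.eval (gp i) y - (Icc (-(c : ℝ)) c).indicator (fun x ↦ Poly.eval (gp i) x) (y - Real.log n) -
          (Icc (-(c : ℝ)) c).indicator (fun x ↦ Poly.eval (gp i) x) (y + Real.log n)) =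
      w1 * (2 * Poly.eval (gp i) y - (Icc (-(c : ℝ)) c).indicator (fun x ↦ Poly.eval (gp i) x) (y - L1) -
          (Icc (-(c : ℝ)) c).indicator (fun x ↦ Poly.eval (gp i) x) (y + L1)) +
        w2 * (2 * Poly.eval (gp i) y - (Icc (-(c : ℝ)) c).indicator (fun x ↦ Poly.eval (gp i) x) (y - L2) -
          (Icc (-(c : ℝ)) c).indicator (fun x ↦ Poly.eval (gp i) x) (y + L2)) +
        w3 * (2 * Poly.eval (gp i) y - (Icc (-(c : ℝ)) c).indicator (fun x ↦ Poly.eval (gp i) x) (y - L3) -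
          (Icc (-(c : ℝ)) c).indicator (fun x ↦ Poly.eval (gp i) x) (y + L3)))
    {m : ℕ} (hm : 0 < m) (n₁ : ℕ) {wI wE : ℚ} (hwI : 0 ≤ wI) (hwE : 0 ≤ wE) (q : ℕ → ℚ)
    (hq : ∀ j, j < m →
      IntervalIntegrable (fun ρ ↦ dt_windowResidual (c : ℝ) gp w1 L1 w2 L2 w3 L3 (Mt : ℝ) (fun a l ↦ (Wt a l : ℝ)) i
        (((PolyMP.panelCentre (c / (2 * m)) j : ℚ) : ℝ) + ρ) ^ 2) volume (-((c / (2 * m) : ℚ) : ℝ)) ((c / (2 * m) : ℚ) : ℝ) →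
      ∫ ρ in (-((c / (2 * m) : ℚ) : ℝ))..((c / (2 * m) : ℚ) : ℝ),
          dt_windowResidual (c : ℝ) gp w1 L1 w2 L2 w3 L3 (Mt : ℝ) (fun a l ↦ (Wt a l : ℝ)) i
        (((PolyMP.panelCentre (c / (2 * m)) j : ℚ) : ℝ) + ρ) ^ 2 ≤ ((q j : ℚ) : ℝ)) :
    ∫ y, dt_wgt (((n₁ : ℚ) * (c / m) : ℚ) : ℝ) (wI : ℝ) (wE : ℝ) y *
        ‖(F i - ∑ l, ((Wt i l : ℝ) + if l = i then (Mt : ℝ) - weilMarkovConstant (c : ℝ) else 0) • v l) y‖ ^ 2 ≤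
      2 * ∑ j ∈ Finset.range m, ((dt_wj n₁ wI wE j * q j : ℚ) : ℝ) := by
  have hc' : (0 : ℝ) < c := by exact_mod_cast hc
  refine dt_residual_wnormSq_le_of_panels hc' hσ (fun l x ↦ Poly.eval (gp l) x) (fun l ↦ dt_contDiff_polyEval (gp l)) hgp v F hv hF
    (fun i l ↦ (Wt i l : ℝ) + if l = i then (Mt : ℝ) - weilMarkovConstant (c : ℝ) else 0) i hm _
    (fun _ hy ↦ dt_residual_eq_windowResidual hc' hv hF (Mt : ℝ) (fun a l ↦ (Wt a l : ℝ)) i hprimes hy)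
    (dt_wgt_measurable _ _ _) (fun y ↦ dt_wgt_abs_le _ _ _ y) (fun y ↦ dt_wgt_neg _ _ _ y)
    (fun j ↦ ((dt_wj n₁ wI wE j * q j : ℚ) : ℝ)) fun j hj ↦ ?_
  have e1 : (2 * (j : ℝ) + 1) * ((c : ℝ) / (2 * m)) = ((PolyMP.panelCentre (c / (2 * m)) j : ℚ) : ℝ) :=
    (dt_panelCentre_castL c m j).symm
  have e2 : (c : ℝ) / (2 * m) = ((c / (2 * m) : ℚ) : ℝ) := (dt_halfWidth_cast c m).symm
  have hRi := dt_windowResidual_sq_intervalIntegrable hc' hv hF (Mt : ℝ) (fun a l ↦ (Wt a l : ℝ)) i hprimes hm hj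
  rw [e1, e2] at hRi ⊢
  have hb := hq j hj hRi
  have hw0 : (0 : ℝ) ≤ ((dt_wj n₁ wI wE j : ℚ) : ℝ) := by
    unfold dt_wj; split_ifs <;> exact_mod_cast (by assumption)
  have := dt_wpanel_sq_le (w := dt_wgt (((n₁ : ℚ) * (c / m) : ℚ) : ℝ) (wI : ℝ) (wE : ℝ))
    (R := fun y ↦ dt_windowResidual (c : ℝ) gp w1 L1 w2 L2 w3 L3 (Mt : ℝ) (fun a l ↦ (Wt a l : ℝ)) i y)
    (y := ((PolyMP.panelCentre (c / (2 * m)) j : ℚ) : ℝ)) (by rw [← e2]; positivity) hw0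
    (fun ρ hρ ↦ dt_wgt_on_panel hc hm n₁ wI wE hρ) hb
  push_cast at this ⊢
  exact this

/-- **Weighted cross term** `2 Σ w_j lo_j ≤ ∫ w·Re((F_i − ΣWv)(conj(F_i' − ΣWv))) ≤ 2 Σ w_j hi_j` from the unweighted per-panel boxes.
[cite: GoerischHaunhorst1985, §2] -/
theorem dt_whcross_of_panelQL (hc : 0 < c) {σ : ℝ} (hσ : σ = 1 ∨ σ = -1)
    (hgp : ∀ i x, Poly.eval (gp i) (-x) = σ * Poly.eval (gp i) x)
    (hv : ∀ i x, v i x = (((Icc (-(c : ℝ)) c).indicator (fun x ↦ Poly.eval (gp i) x) x : ℝ) : ℂ))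
    (hF : ∀ i y, F i y = (Icc (-(c : ℝ)) c).indicator (fun y ↦
        2 * (∫ x, v i x * (Real.cosh (x / 2) : ℂ)) * (Real.cosh (y / 2) : ℂ) -
          2 * (∫ x, v i x * (Real.sinh (x / 2) : ℂ)) * (Real.sinh (y / 2) : ℂ) +
        (∑ n ∈ weilPrimeIndex (c : ℝ), (((ArithmeticFunction.vonMangoldt n : ℝ) / Real.sqrt n : ℝ) : ℂ) *
          (2 * v i y - v i (y - Real.log n) - v i (y + Real.log n))) +
        ∫ t in Ioi 0, (weilArchDensity t : ℂ) * (2 * v i y - v i (y - t) - v i (y + t))) y -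
      (weilMarkovConstant (c : ℝ) : ℂ) * v i y)
    {w1 L1 w2 L2 w3 L3 : ℝ} (Mt : ℚ) (Wt : Fin k → Fin k → ℚ) (i i' : Fin k)
    (hprimes : ∀ y : ℝ, ∑ n ∈ weilPrimeIndex (c : ℝ), ((ArithmeticFunction.vonMangoldt n : ℝ) / Real.sqrt n) *
        (2 * Poly.eval (gp i) y - (Icc (-(c : ℝ)) c).indicator (fun x ↦ Poly.eval (gp i) x) (y - Real.log n) -
          (Icc (-(c : ℝ)) c).indicator (fun x ↦ Poly.eval (gp i) x) (y + Real.log n)) =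
      w1 * (2 * Poly.eval (gp i) y - (Icc (-(c : ℝ)) c).indicator (fun x ↦ Poly.eval (gp i) x) (y - L1) -
          (Icc (-(c : ℝ)) c).indicator (fun x ↦ Poly.eval (gp i) x) (y + L1)) +
        w2 * (2 * Poly.eval (gp i) y - (Icc (-(c : ℝ)) c).indicator (fun x ↦ Poly.eval (gp i) x) (y - L2) -
          (Icc (-(c : ℝ)) c).indicator (fun x ↦ Poly.eval (gp i) x) (y + L2)) +
        w3 * (2 * Poly.eval (gp i) y - (Icc (-(c : ℝ)) c).indicator (fun x ↦ Poly.eval (gp i) x) (y - L3) -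
          (Icc (-(c : ℝ)) c).indicator (fun x ↦ Poly.eval (gp i) x) (y + L3)))
    (hprimes' : ∀ y : ℝ, ∑ n ∈ weilPrimeIndex (c : ℝ), ((ArithmeticFunction.vonMangoldt n : ℝ) / Real.sqrt n) *
        (2 * Poly.eval (gp i') y - (Icc (-(c : ℝ)) c).indicator (fun x ↦ Poly.eval (gp i') x) (y - Real.log n) -
          (Icc (-(c : ℝ)) c).indicator (fun x ↦ Poly.eval (gp i') x) (y + Real.log n)) =
      w1 * (2 * Poly.eval (gp i') y - (Icc (-(c : ℝ)) c).indicator (fun x ↦ Poly.eval (gp i') x) (y - L1) -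
          (Icc (-(c : ℝ)) c).indicator (fun x ↦ Poly.eval (gp i') x) (y + L1)) +
        w2 * (2 * Poly.eval (gp i') y - (Icc (-(c : ℝ)) c).indicator (fun x ↦ Poly.eval (gp i') x) (y - L2) -
          (Icc (-(c : ℝ)) c).indicator (fun x ↦ Poly.eval (gp i') x) (y + L2)) +
        w3 * (2 * Poly.eval (gp i') y - (Icc (-(c : ℝ)) c).indicator (fun x ↦ Poly.eval (gp i') x) (y - L3) -
          (Icc (-(c : ℝ)) c).indicator (fun x ↦ Poly.eval (gp i') x) (y + L3)))
    {m : ℕ} (hm : 0 < m) (n₁ : ℕ) {wI wE : ℚ} (hwI : 0 ≤ wI) (hwE : 0 ≤ wE) (lo hi : ℕ → ℚ)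
    (hq : ∀ j, j < m →
      IntervalIntegrable (fun ρ ↦ dt_windowResidual (c : ℝ) gp w1 L1 w2 L2 w3 L3 (Mt : ℝ) (fun a l ↦ (Wt a l : ℝ)) i
        (((PolyMP.panelCentre (c / (2 * m)) j : ℚ) : ℝ) + ρ) ^ 2) volume (-((c / (2 * m) : ℚ) : ℝ)) ((c / (2 * m) : ℚ) : ℝ) →
      IntervalIntegrable (fun ρ ↦ dt_windowResidual (c : ℝ) gp w1 L1 w2 L2 w3 L3 (Mt : ℝ) (fun a l ↦ (Wt a l : ℝ)) i'
        (((PolyMP.panelCentre (c / (2 * m)) j : ℚ) : ℝ) + ρ) ^ 2) volume (-((c / (2 * m) : ℚ) : ℝ)) ((c / (2 * m) : ℚ) : ℝ) →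
      IntervalIntegrable (fun ρ ↦
        dt_windowResidual (c : ℝ) gp w1 L1 w2 L2 w3 L3 (Mt : ℝ) (fun a l ↦ (Wt a l : ℝ)) i
        (((PolyMP.panelCentre (c / (2 * m)) j : ℚ) : ℝ) + ρ) *
        dt_windowResidual (c : ℝ) gp w1 L1 w2 L2 w3 L3 (Mt : ℝ) (fun a l ↦ (Wt a l : ℝ)) i'
        (((PolyMP.panelCentre (c / (2 * m)) j : ℚ) : ℝ) + ρ)) volume (-((c / (2 * m) : ℚ) : ℝ)) ((c / (2 * m) : ℚ) : ℝ) →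
      ((lo j : ℚ) : ℝ) ≤ ∫ ρ in (-((c / (2 * m) : ℚ) : ℝ))..((c / (2 * m) : ℚ) : ℝ),
          dt_windowResidual (c : ℝ) gp w1 L1 w2 L2 w3 L3 (Mt : ℝ) (fun a l ↦ (Wt a l : ℝ)) i
        (((PolyMP.panelCentre (c / (2 * m)) j : ℚ) : ℝ) + ρ) *
          dt_windowResidual (c : ℝ) gp w1 L1 w2 L2 w3 L3 (Mt : ℝ) (fun a l ↦ (Wt a l : ℝ)) i'
        (((PolyMP.panelCentre (c / (2 * m)) j : ℚ) : ℝ) + ρ) ∧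
      ∫ ρ in (-((c / (2 * m) : ℚ) : ℝ))..((c / (2 * m) : ℚ) : ℝ),
          dt_windowResidual (c : ℝ) gp w1 L1 w2 L2 w3 L3 (Mt : ℝ) (fun a l ↦ (Wt a l : ℝ)) i
        (((PolyMP.panelCentre (c / (2 * m)) j : ℚ) : ℝ) + ρ) *
          dt_windowResidual (c : ℝ) gp w1 L1 w2 L2 w3 L3 (Mt : ℝ) (fun a l ↦ (Wt a l : ℝ)) i'
        (((PolyMP.panelCentre (c / (2 * m)) j : ℚ) : ℝ) + ρ) ≤ ((hi j : ℚ) : ℝ)) :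
    2 * ∑ j ∈ Finset.range m, ((dt_wj n₁ wI wE j * lo j : ℚ) : ℝ) ≤
      ∫ y, dt_wgt (((n₁ : ℚ) * (c / m) : ℚ) : ℝ) (wI : ℝ) (wE : ℝ) y *
        ((F i - ∑ l, ((Wt i l : ℝ) + if l = i then (Mt : ℝ) - weilMarkovConstant (c : ℝ) else 0) • v l) y *
          conj ((F i' - ∑ l, ((Wt i' l : ℝ) + if l = i' then (Mt : ℝ) - weilMarkovConstant (c : ℝ) else 0) • v l) y)).re ∧
    ∫ y, dt_wgt (((n₁ : ℚ) * (c / m) : ℚ) : ℝ) (wI : ℝ) (wE : ℝ) y *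
        ((F i - ∑ l, ((Wt i l : ℝ) + if l = i then (Mt : ℝ) - weilMarkovConstant (c : ℝ) else 0) • v l) y *
          conj ((F i' - ∑ l, ((Wt i' l : ℝ) + if l = i' then (Mt : ℝ) - weilMarkovConstant (c : ℝ) else 0) • v l) y)).re ≤
      2 * ∑ j ∈ Finset.range m, ((dt_wj n₁ wI wE j * hi j : ℚ) : ℝ) := by
  have hc' : (0 : ℝ) < c := by exact_mod_cast hc
  refine dt_residual_wcross_mem_of_panels hc' hσ (fun l x ↦ Poly.eval (gp l) x) (fun l ↦ dt_contDiff_polyEval (gp l)) hgp v F hv hF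
    (fun i l ↦ (Wt i l : ℝ) + if l = i then (Mt : ℝ) - weilMarkovConstant (c : ℝ) else 0) i i' hm _ _
    (fun _ hy ↦ dt_residual_eq_windowResidual hc' hv hF (Mt : ℝ) (fun a l ↦ (Wt a l : ℝ)) i hprimes hy)
    (fun _ hy ↦ dt_residual_eq_windowResidual hc' hv hF (Mt : ℝ) (fun a l ↦ (Wt a l : ℝ)) i' hprimes' hy)
    (dt_wgt_measurable _ _ _) (fun y ↦ dt_wgt_abs_le _ _ _ y) (fun y ↦ dt_wgt_neg _ _ _ y)
    (fun j ↦ ((dt_wj n₁ wI wE j * lo j : ℚ) : ℝ)) (fun j ↦ ((dt_wj n₁ wI wE j * hi j : ℚ) : ℝ)) (fun j hj ↦ ?_) (fun j hj ↦ ?_)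
  all_goals
    have e1 : (2 * (j : ℝ) + 1) * ((c : ℝ) / (2 * m)) = ((PolyMP.panelCentre (c / (2 * m)) j : ℚ) : ℝ) :=
      (dt_panelCentre_castL c m j).symm
    have e2 : (c : ℝ) / (2 * m) = ((c / (2 * m) : ℚ) : ℝ) := (dt_halfWidth_cast c m).symm
    have hR1 := dt_windowResidual_sq_intervalIntegrable hc' hv hF (Mt : ℝ) (fun a l ↦ (Wt a l : ℝ)) i hprimes hm hj
    have hR2 := dt_windowResidual_sq_intervalIntegrable hc' hv hF (Mt : ℝ) (fun a l ↦ (Wt a l : ℝ)) i' hprimes' hm hj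
    have hR3 := dt_windowResidual_mul_intervalIntegrableL hc hv hF Mt Wt i i' hprimes hprimes' hm hj
    rw [e1, e2] at hR1 hR2 ⊢
    have hb := hq j hj hR1 hR2 hR3
    have hw0 : (0 : ℝ) ≤ ((dt_wj n₁ wI wE j : ℚ) : ℝ) := by
      unfold dt_wj; split_ifs <;> exact_mod_cast (by assumption)
    have key := dt_wpanel_mul_mem (w := dt_wgt (((n₁ : ℚ) * (c / m) : ℚ) : ℝ) (wI : ℝ) (wE : ℝ))
      (Ri := fun y ↦ dt_windowResidual (c : ℝ) gp w1 L1 w2 L2 w3 L3 (Mt : ℝ) (fun a l ↦ (Wt a l : ℝ)) i y)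
      (Rk := fun y ↦ dt_windowResidual (c : ℝ) gp w1 L1 w2 L2 w3 L3 (Mt : ℝ) (fun a l ↦ (Wt a l : ℝ)) i' y)
      (y := ((PolyMP.panelCentre (c / (2 * m)) j : ℚ) : ℝ)) (by rw [← e2]; positivity) hw0
      (fun ρ hρ ↦ dt_wgt_on_panel hc hm n₁ wI wE hρ) hb.1 hb.2
    push_cast at key ⊢
  · exact key.1
  · exact key.2

end WPanels

end Summit.RiemannHypothesis.RiemannHypothesis.Theorems.EvenWinsBeyondArch

end
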